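import Literature.NumberTheory.LFunctions.RayClassPairExplicitFormula
import Literature.NumberTheory.LFunctions.DeuringHeilbronnFamily
import HarnessLib

/-!
# Deuring–Heilbronn for congruence class groups, I: the core node family of one primitive Hecke `L`-function

Topic `Literature/NumberTheory/LFunctions` (namespace `Literature.NumberTheory.LFunctions.RayXiData`), the ray-class
counterpart of the tree's `DeuringHeilbronnSlot.lean` / `DeuringHeilbronnSlotSum.lean` / `DeuringHeilbronnFamily.lean`
(class group characters).  Everything here is PROVED; `coreNode`, `coreWt₀`, `coreWt`, `corePair` are definitions with
bodies, `CoreRemoval` is a structure.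

For analytic data `T = (L, L', W)` of conductor `𝔣` and sign type `p` (`RayXiData`), `Dx : SymmHadamardData Ξ_T`, a
point `s` with `Re s > 1` and `μ ≥ 1` (`k = 2μ − 1`), we index the zeros entering the explicit formula
`pairExplicitFormula` by `DH.SlotIdx = (ℕ × Bool) ⊕ Unit ⊕ ℕ`:
* `inl (n, ±)`: the zeros `1/2 ± ζₙ` of `Ξ_T` (weight `1`, or `0` on padding indices);
* `inr (inl ())`: the point `1/2` (weight `2m`);
* `inr (inr j)`: the trivial zero `−j` (weight `2 a_j`, `a_j = trivMult K p j` the multiplicity for ONE of the two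
  characters `χ, χ̄`, which have the same sign type).
Then (`hasSum_coreWt₀`) `Σ_i w_i (s − ω_i)^{−2μ} = 2(s−1)^{−2μ} + 2s^{−2μ} − P^core_k(s)` with
`P^core_k(s) = ((−1)^{k+1}/k!)[(L'/L)^{(k)}(s) + (L''/L')^{(k)}(s)]` (`corePair`); the `M`-bound (`tsum_coreWt₀_mul_norm_le`)
`Σ_i w_i|s − ω_i|^{−2} ≤ (Re s − 1)^{−1} Re[2/s + 2/(s−1) + log A + 2L_∞'/L_∞(s) + L'/L(s) + L''/L'(s)] + 2 n_K Z₂`;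
and with the REMOVAL (`CoreRemoval`: the two factor indices carrying the artificial zeros `{1, 0}` of `Ξ_T`, which are
always present since `ξ(1) = 0`, and — when the flag `w` holds — two node indices carrying an exceptional zero `β`)
`Σ_i w'_i (s − ω_i)^{−2μ} = −P^core_k(s) − |B| (s − β)^{−2μ}` (`hasSum_coreWt`).
[cite: ThornerZaman2017, §7.2 (7.7)–(7.8)] [cite: LagariasMontgomeryOdlyzko1979, §4]

## References
* J. Thorner, A. Zaman, Algebra Number Theory 11 (2017), §7. [ThornerZaman2017]
* J. C. Lagarias, H. L. Montgomery, A. M. Odlyzko, Invent. Math. 54 (1979), §3–4. [LagariasMontgomeryOdlyzko1979]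
-/

noncomputable section

open scoped NumberField
open Complex Filter Topology Set NumberField NumberField.InfinitePlace IsDedekindDomain Classical

namespace Literature.NumberTheory.LFunctions

open Literature.NumberTheory.LFunctions.NumberField Literature.NumberTheory.LFunctions.NumberField.DH
  Literature.NumberTheory.LFunctions.Stark1974

variable {K : Type*} [Field K] [NumberField K]
variable {𝔣 : Ideal (𝓞 K)} {p : Finset {w : InfinitePlace K // IsReal w}}

namespace RayXiData

variable (T : RayXiData K 𝔣 p) (Dx : SymmHadamardData T.xiPair)

/-! ### Nodes, weights, the Dirichlet side -/

/-- The nodes: zeros `1/2 ± ζₙ` of `Ξ_T`, the point `1/2`, the trivial zeros `−j`. [cite: ThornerZaman2017, §7.2 (7.8)] -/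
def coreNode : SlotIdx → ℂ
  | Sum.inl q => Dx.nodeVal q
  | Sum.inr (Sum.inl _) => 1 / 2
  | Sum.inr (Sum.inr j) => -(j : ℂ)

omit T Dx in
variable (K p) in
/-- The weight `2 a_j` of the trivial zero `−j` for the pair `ξ(χ)ξ(χ̄)`. [cite: ThornerZaman2017, §2 (2.4)] -/
def coreTrivWt (j : ℕ) : ℝ := 2 * trivMult K p j

/-- The unremoved weights. [cite: ThornerZaman2017, §7.2 (7.8)] -/
def coreWt₀ : SlotIdx → ℝ
  | Sum.inl q => Dx.nodeWt q
  | Sum.inr (Sum.inl _) => 2 * Dx.m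
  | Sum.inr (Sum.inr j) => coreTrivWt K p j

/-- The weights with the factor indices `n ∈ A` (both nodes) and the single nodes `q ∈ B` removed.
[cite: ThornerZaman2017, §7.2 ("ω ≠ β₁")] -/
def coreWt (A : Finset ℕ) (B : Finset (ℕ × Bool)) : SlotIdx → ℝ
  | Sum.inl q => if q.1 ∈ A then 0 else if q ∈ B then 0 else Dx.nodeWt q
  | Sum.inr x => T.coreWt₀ Dx (Sum.inr x)

/-- **The Dirichlet side** `P^core_k(s) = ((−1)^{k+1}/k!)[(L'/L)^{(k)}(s) + (L''/L')^{(k)}(s)]` (for odd `k` this is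
`(1/k!) Σ_𝔫 (Λ_χ + Λ_χ̄)(𝔫)(log N𝔫)^k N𝔫^{-s}` for the primitive characters). [cite: ThornerZaman2017, §7.2 (7.7)] -/
def corePair (k : ℕ) (s : ℂ) : ℂ :=
  ((-1) ^ (k + 1) / k.factorial : ℂ) * (iteratedDeriv k (logDeriv T.L) s + iteratedDeriv k (logDeriv T.L') s)

/-! ### Unfolding lemmas -/

/-- Unfolding. [folklore] -/
@[simp] private theorem coreNode_inl (q : ℕ × Bool) : T.coreNode Dx (Sum.inl q) = Dx.nodeVal q := rfl
/-- Unfolding. [folklore] -/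
@[simp] private theorem coreNode_center (u : Unit) : T.coreNode Dx (Sum.inr (Sum.inl u)) = 1 / 2 := rfl
/-- Unfolding. [folklore] -/
@[simp] private theorem coreNode_triv (j : ℕ) : T.coreNode Dx (Sum.inr (Sum.inr j)) = -(j : ℂ) := rfl
/-- Unfolding. [folklore] -/
@[simp] private theorem coreWt₀_inl (q : ℕ × Bool) : T.coreWt₀ Dx (Sum.inl q) = Dx.nodeWt q := rfl
/-- Unfolding. [folklore] -/
@[simp] private theorem coreWt₀_center (u : Unit) : T.coreWt₀ Dx (Sum.inr (Sum.inl u)) = 2 * Dx.m := rfl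
/-- Unfolding. [folklore] -/
@[simp] private theorem coreWt₀_triv (j : ℕ) : T.coreWt₀ Dx (Sum.inr (Sum.inr j)) = coreTrivWt K p j := rfl

/-! ### Basic properties of the weights and nodes -/

omit T Dx in
/-- `0 ≤ 2a_j ≤ 2 n_K`. [cite: ThornerZaman2017, §2 (2.3)] -/
theorem coreTrivWt_nonneg_le (j : ℕ) : 0 ≤ coreTrivWt K p j ∧ coreTrivWt K p j ≤ 2 * Module.finrank ℚ K := by
  have h := trivMult_le (K := K) p j
  have h' : (trivMult K p j : ℝ) ≤ Module.finrank ℚ K := by exact_mod_cast h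
  unfold coreTrivWt
  constructor <;> nlinarith [(Nat.cast_nonneg (trivMult K p j) : (0 : ℝ) ≤ _)]

omit T Dx in
/-- A positive trivial weight is `≥ 1` (it is an even integer). [cite: ThornerZaman2017, §7.2] -/
theorem one_le_coreTrivWt_of_pos {j : ℕ} (h : 0 < coreTrivWt K p j) : 1 ≤ coreTrivWt K p j := by
  unfold coreTrivWt at h ⊢
  have : 0 < trivMult K p j := by exact_mod_cast (show (0 : ℝ) < trivMult K p j by linarith)
  have : (1 : ℝ) ≤ trivMult K p j := by exact_mod_cast this
  linarith

/-- **The weights are non-negative.** [cite: ThornerZaman2017, §7.2] -/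
theorem coreWt₀_nonneg (i : SlotIdx) : 0 ≤ T.coreWt₀ Dx i := by
  rcases i with q | u | j
  · exact Dx.nodeWt_nonneg q
  · simp [coreWt₀]
  · exact (coreTrivWt_nonneg_le (K := K) (p := p) j).1

/-- **A positive weight is at least `1`.** [cite: ThornerZaman2017, §7.2] -/
theorem one_le_coreWt₀_of_pos {i : SlotIdx} (h : 0 < T.coreWt₀ Dx i) : 1 ≤ T.coreWt₀ Dx i := by
  rcases i with q | u | j
  · simp only [coreWt₀_inl] at h ⊢; rw [Dx.nodeWt_eq_one_of_pos h]
  · simp only [coreWt₀_center] at h ⊢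
    have : 0 < Dx.m := by exact_mod_cast (show (0 : ℝ) < Dx.m by linarith)
    have : (1 : ℝ) ≤ Dx.m := by exact_mod_cast this
    linarith
  · exact one_le_coreTrivWt_of_pos h

/-- **The nodes of positive weight lie in `Re ≤ 1`.** [cite: ThornerZaman2017, §7.2] -/
theorem coreNode_re_le_one {i : SlotIdx} (h : 0 < T.coreWt₀ Dx i) : (T.coreNode Dx i).re ≤ 1 := by
  rcases i with q | u | j
  · exact Dx.nodeVal_re_le_one h
  · simp [coreNode]; norm_num
  · simp [coreNode]; linarith [(j.cast_nonneg : (0 : ℝ) ≤ j)]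

/-- `0 ≤ w' ≤ w`. [cite: ThornerZaman2017, §7.2] -/
theorem coreWt_nonneg_le (A : Finset ℕ) (B : Finset (ℕ × Bool)) (i : SlotIdx) :
    0 ≤ T.coreWt Dx A B i ∧ T.coreWt Dx A B i ≤ T.coreWt₀ Dx i := by
  rcases i with q | x
  · simp only [coreWt, coreWt₀_inl]
    split_ifs
    · exact ⟨le_rfl, Dx.nodeWt_nonneg q⟩
    · exact ⟨le_rfl, Dx.nodeWt_nonneg q⟩
    · exact ⟨Dx.nodeWt_nonneg q, le_rfl⟩
  · simp only [coreWt]; exact ⟨T.coreWt₀_nonneg Dx _, le_rfl⟩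

/-- A positive modified weight is `≥ 1`. [cite: ThornerZaman2017, §7.2] -/
theorem one_le_coreWt_of_pos (A : Finset ℕ) (B : Finset (ℕ × Bool)) {i : SlotIdx} (h : 0 < T.coreWt Dx A B i) :
    1 ≤ T.coreWt Dx A B i := by
  rcases i with q | x
  · simp only [coreWt] at h ⊢
    split_ifs at h ⊢ with h1 h2
    · exact absurd h (lt_irrefl 0)
    · exact absurd h (lt_irrefl 0)
    · exact T.one_le_coreWt₀_of_pos Dx (i := Sum.inl q) h
  · simp only [coreWt] at h ⊢; exact T.one_le_coreWt₀_of_pos Dx h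

/-- A node of positive weight whose value is none of `1, 0` and the removed value `β` keeps a positive weight after the
removal (when the `A`-indices carry the pair `{1, 0}` and the `B`-indices the value `β`). [cite: ThornerZaman2017, §7.2] -/
theorem coreWt_pos (A : Finset ℕ) (hA : ∀ n ∈ A, Dx.c n * (1 - 1 / 2) ^ 2 = -1) (B : Finset (ℕ × Bool)) {β : ℂ}
    (hB : ∀ q ∈ B, Dx.nodeVal q = β) {i : SlotIdx} (h : 0 < T.coreWt₀ Dx i) (h1 : T.coreNode Dx i ≠ 1)
    (h0 : T.coreNode Dx i ≠ 0) (hβ : T.coreNode Dx i ≠ β) : 0 < T.coreWt Dx A B i := by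
  rcases i with q | x
  · simp only [coreWt, coreNode_inl, coreWt₀_inl] at h h1 h0 hβ ⊢
    have hnA : q.1 ∉ A := by
      intro hq
      obtain ⟨b, hb, hb'⟩ := Dx.nodeVal_pair_of_root (hA q.1 hq)
      rw [sub_self] at hb'
      rcases q with ⟨n, b'⟩
      by_cases hbb : b' = b
      · subst hbb; exact h1 hb
      · have : b' = !b := by cases b <;> cases b' <;> simp_all
        subst this; exact h0 hb'
    have hnB : q ∉ B := fun hq ↦ hβ (hB q hq)
    rw [if_neg hnA, if_neg hnB]; exact h
  · simpa [coreWt] using h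

/-! ### Zeros are nodes -/

/-- A zero of `Ξ_T` is a node of positive (unremoved) weight. [cite: ThornerZaman2017, §7.2] -/
theorem exists_idx_of_xiPair_eq_zero {ρ : ℂ} (hρ : T.xiPair ρ = 0) :
    ∃ i : SlotIdx, 0 < T.coreWt₀ Dx i ∧ T.coreNode Dx i = ρ := by
  by_cases h : ρ = 1 / 2
  · refine ⟨Sum.inr (Sum.inl ()), ?_, by simp [coreNode, h]⟩
    simp only [coreWt₀_center]
    have hm : Dx.m ≠ 0 := by
      intro hm
      have := Dx.apply_eq (1 / 2 : ℂ)
      rw [← h, hρ, hm, mul_zero, pow_zero, one_mul, h, sub_self] at this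
      simp only [ne_eq, OfNat.ofNat_ne_zero, not_false_eq_true, zero_pow, mul_zero, add_zero,
        tprod_one, mul_one] at this
      exact Dx.A_ne this.symm
    have : (1 : ℝ) ≤ Dx.m := by exact_mod_cast Nat.one_le_iff_ne_zero.mpr hm
    linarith
  · obtain ⟨q, hq, hqv⟩ := Dx.exists_nodeVal_eq_of_zero hρ h
    exact ⟨Sum.inl q, by simp [hq], by simp [hqv]⟩

/-- **A zero `ρ` of `L` with `Re ρ > 0`, `ρ ∉ {1, 0, β}`, is a node of positive weight after the removal.** [cite: ThornerZaman2017, §7.2] -/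
theorem exists_idx_of_L_eq_zero (A : Finset ℕ) (hA : ∀ n ∈ A, Dx.c n * (1 - 1 / 2) ^ 2 = -1) (B : Finset (ℕ × Bool))
    {β : ℂ} (hB : ∀ q ∈ B, Dx.nodeVal q = β) {ρ : ℂ} (hρ0 : 0 < ρ.re) (hρ1 : ρ ≠ 1) (hρβ : ρ ≠ β)
    (hρ : T.L ρ = 0) : ∃ i : SlotIdx, 0 < T.coreWt Dx A B i ∧ T.coreNode Dx i = ρ := by
  obtain ⟨i, hi, hiv⟩ := T.exists_idx_of_xiPair_eq_zero Dx (T.xiPair_eq_zero_of_L_eq_zero hρ0 hρ)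
  have hρ00 : ρ ≠ 0 := fun h ↦ by rw [h, zero_re] at hρ0; exact lt_irrefl _ hρ0
  exact ⟨i, T.coreWt_pos Dx A hA B hB hi (hiv ▸ hρ1) (hiv ▸ hρ00) (hiv ▸ hρβ), hiv⟩

/-! ### The node sum -/

section nodeSum

variable {s : ℂ}

omit T Dx in
/-- The trivial-zero part of the node sum: `Σ_j 2a_j (s + j)^{−m}`, summable with the stated sum, for `Re s ≥ 1`,
`m ≥ 2`. [cite: ThornerZaman2017, §7.2 (7.8)] -/
theorem hasSum_coreTrivWt (hs : 1 ≤ s.re) {m : ℕ} (hm : 2 ≤ m) :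
    HasSum (fun j : ℕ ↦ (coreTrivWt K p j : ℂ) * ((s - (-(j : ℂ))) ^ m)⁻¹)
      (2 * ∑' j : ℕ, (trivMult K p j : ℂ) * ((s + j) ^ m)⁻¹) := by
  have hS := DH.summable_norm_inv_pow_add_nat hs hm
  have hsum : Summable fun j : ℕ ↦ (trivMult K p j : ℂ) * ((s + j) ^ m)⁻¹ := by
    refine Summable.of_norm_bounded (hS.mul_left (Module.finrank ℚ K : ℝ)) fun j ↦ ?_
    rw [norm_mul, Complex.norm_natCast]
    exact mul_le_mul_of_nonneg_right (by exact_mod_cast trivMult_le (K := K) p j) (norm_nonneg _)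
  have h := hsum.hasSum.mul_left (2 : ℂ)
  refine h.congr_fun fun j ↦ ?_
  simp only [coreTrivWt, sub_neg_eq_add]; push_cast; ring

/-- **The explicit formula as a node sum** (unremoved): for `1 < Re s` and `μ ≥ 1`,
`Σ_i w_i (s − ω_i)^{−2μ} = 2(s−1)^{−2μ} + 2s^{−2μ} − P^core_{2μ−1}(s)`. [cite: ThornerZaman2017, §7.2 (7.7)] -/
theorem hasSum_coreWt₀ (hs : 1 < s.re) {μ : ℕ} (hμ : 1 ≤ μ) :
    HasSum (fun i : SlotIdx ↦ (T.coreWt₀ Dx i : ℂ) * ((s - T.coreNode Dx i) ^ (2 * μ))⁻¹)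
      (2 * ((s - 1) ^ (2 * μ))⁻¹ + 2 * (s ^ (2 * μ))⁻¹ - T.corePair (2 * μ - 1) s) := by
  have hΞ := T.differentiable_xiPair
  have hΞs := T.xiPair_ne_zero_of_one_lt_re hs
  have hk1 : 1 ≤ 2 * μ - 1 := by omega
  have hk : 2 * μ - 1 + 1 = 2 * μ := by omega
  -- the three pieces
  have hA : HasSum (fun q : ℕ × Bool ↦ (Dx.nodeWt q : ℂ) * ((s - Dx.nodeVal q) ^ (2 * μ))⁻¹)
      (∑' n, Dx.zeroTerm (2 * μ - 1) s n) := by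
    have := Dx.hasSum_nodeWt_mul_inv_pow hΞ hs hΞs hk1
    rwa [hk] at this
  have hB : HasSum (fun _ : Unit ↦ (2 * Dx.m : ℂ) * ((s - 1 / 2) ^ (2 * μ))⁻¹)
      ((2 * Dx.m : ℂ) * ((s - 1 / 2) ^ (2 * μ))⁻¹) := by
    convert hasSum_fintype (fun _ : Unit ↦ (2 * Dx.m : ℂ) * ((s - 1 / 2) ^ (2 * μ))⁻¹) using 1
    simp
  have hC := hasSum_coreTrivWt (K := K) (p := p) hs.le (m := 2 * μ) (by omega)
  have hBC : HasSum ((fun i : SlotIdx ↦ (T.coreWt₀ Dx i : ℂ) * ((s - T.coreNode Dx i) ^ (2 * μ))⁻¹) ∘ Sum.inr)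
      ((2 * Dx.m : ℂ) * ((s - 1 / 2) ^ (2 * μ))⁻¹ + 2 * ∑' j : ℕ, (trivMult K p j : ℂ) * ((s + j) ^ (2 * μ))⁻¹) := by
    refine HasSum.sum ?_ ?_
    · refine hB.congr_fun fun u ↦ ?_
      simp only [Function.comp_apply, coreWt₀_center, coreNode_center]; push_cast; ring
    · refine hC.congr_fun fun j ↦ ?_
      simp only [Function.comp_apply, coreWt₀_triv, coreNode_triv]
  have hall := HasSum.sum (f := fun i : SlotIdx ↦ (T.coreWt₀ Dx i : ℂ) * ((s - T.coreNode Dx i) ^ (2 * μ))⁻¹)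
    (hA.congr_fun fun q ↦ by simp only [Function.comp_apply, coreWt₀_inl, coreNode_inl]) hBC
  convert hall using 1
  have hpef := T.pairExplicitFormula Dx hs hk1
  rw [corePair, hpef, hk]
  ring

/-- **The node sum with the removal**: if every `n ∈ A` carries the pair of zeros `{1, 0}` and every `q ∈ B` is a
node of weight `1` with value `β`, `q.1 ∉ A`, then
`Σ_i w'_i (s − ω_i)^{−2μ} = 2(s−1)^{−2μ} + 2s^{−2μ} − P^core − |A|((s−1)^{−2μ} + s^{−2μ}) − |B|(s−β)^{−2μ}`.
[cite: ThornerZaman2017, §7.2 (7.7)–(7.8)] -/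
theorem hasSum_coreWt (hs : 1 < s.re) {μ : ℕ} (hμ : 1 ≤ μ) (A : Finset ℕ)
    (hA : ∀ n ∈ A, Dx.c n * (1 - 1 / 2) ^ 2 = -1) (B : Finset (ℕ × Bool)) {β : ℂ}
    (hB : ∀ q ∈ B, Dx.nodeWt q = 1 ∧ Dx.nodeVal q = β) (hAB : ∀ q ∈ B, q.1 ∉ A) :
    HasSum (fun i : SlotIdx ↦ (T.coreWt Dx A B i : ℂ) * ((s - T.coreNode Dx i) ^ (2 * μ))⁻¹)
      (2 * ((s - 1) ^ (2 * μ))⁻¹ + 2 * (s ^ (2 * μ))⁻¹ - T.corePair (2 * μ - 1) s -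
        A.card * (((s - 1) ^ (2 * μ))⁻¹ + (s ^ (2 * μ))⁻¹) - B.card * ((s - β) ^ (2 * μ))⁻¹) := by
  have hfull := T.hasSum_coreWt₀ Dx hs hμ
  set f : SlotIdx → ℂ := fun i ↦ (T.coreWt₀ Dx i : ℂ) * ((s - T.coreNode Dx i) ^ (2 * μ))⁻¹ with hf
  set g : SlotIdx → ℂ := fun i ↦ (T.coreWt Dx A B i : ℂ) * ((s - T.coreNode Dx i) ^ (2 * μ))⁻¹ with hg
  set R₀ : Finset (ℕ × Bool) := A ×ˢ Finset.univ ∪ B with hR₀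
  set R : Finset SlotIdx := R₀.map ⟨Sum.inl, Sum.inl_injective⟩ with hR
  have hdiff_zero : ∀ i ∉ R, f i - g i = 0 := by
    intro i hi
    rcases i with q | x
    · have hq : q ∉ R₀ := fun hq ↦ hi (Finset.mem_map.mpr ⟨q, hq, rfl⟩)
      rw [hR₀, Finset.mem_union, Finset.mem_product] at hq
      push Not at hq
      have h1 : q.1 ∉ A := fun h ↦ hq.1 h (Finset.mem_univ _)
      simp only [hf, hg, coreWt, coreWt₀_inl, if_neg h1, if_neg hq.2, sub_self]
    · simp only [hf, hg, coreWt, sub_self]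
  have hrem : HasSum (fun i ↦ f i - g i) (∑ i ∈ R, (f i - g i)) := hasSum_sum_of_ne_finset_zero hdiff_zero
  have hk : 2 * μ - 1 + 1 = 2 * μ := by omega
  have hval : ∑ i ∈ R, (f i - g i) =
      A.card * (((s - 1) ^ (2 * μ))⁻¹ + (s ^ (2 * μ))⁻¹) + B.card * ((s - β) ^ (2 * μ))⁻¹ := by
    rw [hR, Finset.sum_map]
    simp only [Function.Embedding.coeFn_mk]
    have hdisj : Disjoint (A ×ˢ (Finset.univ : Finset Bool)) B := by
      rw [Finset.disjoint_left]
      intro q hq hqB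
      exact hAB q hqB (Finset.mem_product.mp hq).1
    rw [hR₀, Finset.sum_union hdisj]
    congr 1
    · rw [Finset.sum_product]
      have : ∀ n ∈ A, ∑ b : Bool, (f (Sum.inl (n, b)) - g (Sum.inl (n, b))) =
          ((s - 1) ^ (2 * μ))⁻¹ + (s ^ (2 * μ))⁻¹ := by
        intro n hn
        have hZ := Dx.zeroTerm_eq_of_root (hA n hn) (2 * μ - 1) s
        rw [hk, sub_self, sub_zero] at hZ
        rw [← hZ, Dx.zeroTerm_eq_sum_bool, hk]
        refine Finset.sum_congr rfl fun b _ ↦ ?_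
        simp only [hf, hg, coreWt, coreWt₀_inl, coreNode_inl, if_pos hn]
        push_cast; ring
      rw [Finset.sum_congr rfl this, Finset.sum_const, nsmul_eq_mul]
    · have : ∀ q ∈ B, f (Sum.inl q) - g (Sum.inl q) = ((s - β) ^ (2 * μ))⁻¹ := by
        intro q hq
        obtain ⟨hw, hv⟩ := hB q hq
        simp only [hf, hg, coreWt, coreWt₀_inl, coreNode_inl, if_neg (hAB q hq), if_pos hq, hw, hv]
        push_cast; ring
      rw [Finset.sum_congr rfl this, Finset.sum_const, nsmul_eq_mul]
  have this := hfull.sub hrem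
  rw [hval] at this
  have e : 2 * ((s - 1) ^ (2 * μ))⁻¹ + 2 * (s ^ (2 * μ))⁻¹ - T.corePair (2 * μ - 1) s -
        A.card * (((s - 1) ^ (2 * μ))⁻¹ + (s ^ (2 * μ))⁻¹) - B.card * ((s - β) ^ (2 * μ))⁻¹ =
      2 * ((s - 1) ^ (2 * μ))⁻¹ + 2 * (s ^ (2 * μ))⁻¹ - T.corePair (2 * μ - 1) s -
        ((A.card : ℂ) * (((s - 1) ^ (2 * μ))⁻¹ + (s ^ (2 * μ))⁻¹) + B.card * ((s - β) ^ (2 * μ))⁻¹) := by ring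
  rw [e]
  exact this.congr_fun fun i ↦ by ring

end nodeSum

/-! ### The `M`-bound -/

section mBound

variable {s : ℂ}

omit T Dx in
/-- The trivial-zero part of the `M`-bound: `Σ_j 2a_j |s + j|^{−2} ≤ 2 n_K Z₂`, and summability (`Re s ≥ 1`).
[cite: ThornerZaman2017, Lemma 7.3] -/
theorem summable_coreTrivWt_mul_norm (hs : 1 ≤ s.re) :
    Summable (fun j : ℕ ↦ coreTrivWt K p j * ‖((s - (-(j : ℂ))) ^ 2)⁻¹‖) ∧
      ∑' j : ℕ, coreTrivWt K p j * ‖((s - (-(j : ℂ))) ^ 2)⁻¹‖ ≤ 2 * Module.finrank ℚ K * zetaTwo := by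
  have hb : Summable fun j : ℕ ↦ 1 / ((j : ℝ) + 1) ^ 2 :=
    Literature.Analysis.SpecialFunctions.Complex.summable_one_div_nat_add_one_sq
  have hle : ∀ j : ℕ, coreTrivWt K p j * ‖((s - (-(j : ℂ))) ^ 2)⁻¹‖ ≤
      2 * Module.finrank ℚ K * (1 / ((j : ℝ) + 1) ^ 2) := by
    intro j
    obtain ⟨hw0, hw⟩ := coreTrivWt_nonneg_le (K := K) (p := p) j
    have h1 := DH.one_add_le_norm_add_nat hs j
    have hpos : 0 < 1 + (j : ℝ) := by positivity
    have hn : ‖((s - (-(j : ℂ))) ^ 2)⁻¹‖ ≤ 1 / ((j : ℝ) + 1) ^ 2 := by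
      rw [sub_neg_eq_add, norm_inv, norm_pow, one_div]
      apply inv_anti₀ (by positivity)
      rw [add_comm (j : ℝ) 1]
      exact pow_le_pow_left₀ hpos.le h1 2
    calc coreTrivWt K p j * ‖((s - (-(j : ℂ))) ^ 2)⁻¹‖ ≤ coreTrivWt K p j * (1 / ((j : ℝ) + 1) ^ 2) := by gcongr
      _ ≤ 2 * Module.finrank ℚ K * (1 / ((j : ℝ) + 1) ^ 2) := by gcongr
  have hsum : Summable (fun j : ℕ ↦ coreTrivWt K p j * ‖((s - (-(j : ℂ))) ^ 2)⁻¹‖) :=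
    Summable.of_nonneg_of_le (fun j ↦ mul_nonneg (coreTrivWt_nonneg_le (K := K) (p := p) j).1 (norm_nonneg _))
      hle (hb.mul_left _)
  refine ⟨hsum, ?_⟩
  calc ∑' j : ℕ, coreTrivWt K p j * ‖((s - (-(j : ℂ))) ^ 2)⁻¹‖
      ≤ ∑' j : ℕ, 2 * Module.finrank ℚ K * (1 / ((j : ℝ) + 1) ^ 2) := hsum.tsum_le_tsum hle (hb.mul_left _)
    _ = 2 * Module.finrank ℚ K * zetaTwo := by rw [tsum_mul_left]; rfl

/-- **Summability of the node family with exponent `2`.** [cite: ThornerZaman2017, Lemma 7.4] -/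
theorem summable_coreWt₀_mul_norm (hs : 1 < s.re) :
    Summable fun i : SlotIdx ↦ T.coreWt₀ Dx i * ‖((s - T.coreNode Dx i) ^ 2)⁻¹‖ := by
  have hΞ := T.differentiable_xiPair
  have hΞs := T.xiPair_ne_zero_of_one_lt_re hs
  have hA := Dx.summable_nodeWt_mul_norm_inv_sq hΞ hs hΞs
  have hC := (summable_coreTrivWt_mul_norm (K := K) (p := p) hs.le).1
  set F : SlotIdx → ℝ := fun i ↦ T.coreWt₀ Dx i * ‖((s - T.coreNode Dx i) ^ 2)⁻¹‖ with hF
  have hA' : Summable (F ∘ Sum.inl) := hA.congr fun q ↦ rfl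
  have hB' : Summable ((F ∘ Sum.inr) ∘ Sum.inl) := (hasSum_fintype _).summable
  have hC' : Summable ((F ∘ Sum.inr) ∘ Sum.inr) := hC.congr fun j ↦ rfl
  exact Summable.sum F hA' (Summable.sum (F ∘ Sum.inr) hB' hC')

/-- The value at `k = 0`: `Re[2m/(s−½) + Σₙ Zₙ(0,s)] = Re Ξ'/Ξ(s)`. [cite: ThornerZaman2017, §7.2] -/
theorem re_pole_add_zeroTerm_eq (hs : 1 < s.re) :
    (2 * (Dx.m : ℂ) * (s - 1 / 2)⁻¹ + ∑' n, Dx.zeroTerm 0 s n).re = (logDeriv T.xiPair s).re := by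
  have hΞ := T.differentiable_xiPair
  have hΞs := T.xiPair_ne_zero_of_one_lt_re hs
  have h0 := Dx.iteratedDeriv_logDeriv_eq hΞ hΞs 0
  simp only [iteratedDeriv_zero, pow_zero, Nat.factorial_zero, Nat.cast_one, one_mul, zero_add,
    pow_one] at h0
  rw [← h0]

/-- **The `M`-bound for the core family**: for `1 < Re s`,
`Σ_i w_i |s − ω_i|^{−2} ≤ (Re s − 1)^{−1} Re Ξ'/Ξ(s) + 2 n_K Z₂`. [cite: ThornerZaman2017, Lemmas 7.3–7.4] -/
theorem tsum_coreWt₀_mul_norm_le (hs : 1 < s.re) :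
    ∑' i : SlotIdx, T.coreWt₀ Dx i * ‖((s - T.coreNode Dx i) ^ 2)⁻¹‖ ≤
      (s.re - 1)⁻¹ * (logDeriv T.xiPair s).re + 2 * Module.finrank ℚ K * zetaTwo := by
  have hΞ := T.differentiable_xiPair
  have hΞs := T.xiPair_ne_zero_of_one_lt_re hs
  have hα : 0 < s.re - 1 := by linarith
  have hA := Dx.summable_nodeWt_mul_norm_inv_sq hΞ hs hΞs
  have hAle := Dx.tsum_nodeWt_mul_norm_inv_sq_le hΞ hs hΞs
  obtain ⟨hC, hCle⟩ := summable_coreTrivWt_mul_norm (K := K) (p := p) hs.le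
  set F : SlotIdx → ℝ := fun i ↦ T.coreWt₀ Dx i * ‖((s - T.coreNode Dx i) ^ 2)⁻¹‖ with hF
  have hA' : Summable (F ∘ Sum.inl) := hA.congr fun q ↦ rfl
  have hB' : Summable ((F ∘ Sum.inr) ∘ Sum.inl) := (hasSum_fintype _).summable
  have hC' : Summable ((F ∘ Sum.inr) ∘ Sum.inr) := hC.congr fun j ↦ rfl
  have hsplit : ∑' i : SlotIdx, F i =
      (∑' q : ℕ × Bool, Dx.nodeWt q * ‖((s - Dx.nodeVal q) ^ 2)⁻¹‖) +
        ((2 * Dx.m * ‖((s - 1 / 2) ^ 2)⁻¹‖) + ∑' j : ℕ, coreTrivWt K p j * ‖((s - (-(j : ℂ))) ^ 2)⁻¹‖) := by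
    rw [Summable.tsum_sum hA' (Summable.sum (F ∘ Sum.inr) hB' hC'),
      show (∑' i : Unit ⊕ ℕ, F (Sum.inr i)) = ∑' i, (F ∘ Sum.inr) i from rfl, Summable.tsum_sum hB' hC']
    simp only [Function.comp_def, hF, coreWt₀_inl, coreNode_inl, coreWt₀_center, coreNode_center,
      coreWt₀_triv, coreNode_triv, tsum_fintype, Finset.univ_unique, Finset.sum_singleton]
  rw [hsplit]
  have hcen : 2 * (Dx.m : ℝ) * ‖((s - 1 / 2) ^ 2)⁻¹‖ ≤ (s.re - 1)⁻¹ * (2 * (Dx.m : ℂ) * (s - 1 / 2)⁻¹).re := by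
    have h := norm_inv_sq_le_mul_re_inv (s := s) (ρ := 1 / 2) (by norm_num) hs
    have hm : (0 : ℝ) ≤ 2 * Dx.m := by positivity
    have : (2 * (Dx.m : ℂ) * (s - 1 / 2)⁻¹).re = 2 * Dx.m * ((s - 1 / 2)⁻¹).re := by
      rw [show (2 * (Dx.m : ℂ)) = ((2 * Dx.m : ℝ) : ℂ) by push_cast; ring, Complex.re_ofReal_mul]
    rw [this]
    calc 2 * (Dx.m : ℝ) * ‖((s - 1 / 2) ^ 2)⁻¹‖ ≤ 2 * Dx.m * ((s.re - 1)⁻¹ * ((s - 1 / 2)⁻¹).re) :=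
          mul_le_mul_of_nonneg_left h hm
      _ = (s.re - 1)⁻¹ * (2 * Dx.m * ((s - 1 / 2)⁻¹).re) := by ring
  have key := T.re_pole_add_zeroTerm_eq Dx hs
  rw [add_re] at key
  have htot : (∑' q : ℕ × Bool, Dx.nodeWt q * ‖((s - Dx.nodeVal q) ^ 2)⁻¹‖) + 2 * Dx.m * ‖((s - 1 / 2) ^ 2)⁻¹‖ ≤
      (s.re - 1)⁻¹ * (logDeriv T.xiPair s).re := by
    rw [← key]
    nlinarith [hAle, hcen, inv_pos.mpr hα]
  linarith

/-- Summability and the `M`-bound survive the removal (`0 ≤ w' ≤ w`). [cite: ThornerZaman2017, Lemma 7.4] -/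
theorem summable_coreWt_mul_norm (hs : 1 < s.re) (A : Finset ℕ) (B : Finset (ℕ × Bool)) :
    Summable (fun i : SlotIdx ↦ T.coreWt Dx A B i * ‖((s - T.coreNode Dx i) ^ 2)⁻¹‖) ∧
      ∑' i : SlotIdx, T.coreWt Dx A B i * ‖((s - T.coreNode Dx i) ^ 2)⁻¹‖ ≤
        (s.re - 1)⁻¹ * (logDeriv T.xiPair s).re + 2 * Module.finrank ℚ K * zetaTwo := by
  have h0 := T.summable_coreWt₀_mul_norm Dx hs
  have hle : ∀ i, T.coreWt Dx A B i * ‖((s - T.coreNode Dx i) ^ 2)⁻¹‖ ≤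
      T.coreWt₀ Dx i * ‖((s - T.coreNode Dx i) ^ 2)⁻¹‖ := fun i ↦
    mul_le_mul_of_nonneg_right (T.coreWt_nonneg_le Dx A B i).2 (norm_nonneg _)
  have h1 : Summable fun i : SlotIdx ↦ T.coreWt Dx A B i * ‖((s - T.coreNode Dx i) ^ 2)⁻¹‖ :=
    Summable.of_nonneg_of_le (fun i ↦ mul_nonneg (T.coreWt_nonneg_le Dx A B i).1 (norm_nonneg _)) hle h0
  exact ⟨h1, (h1.tsum_le_tsum hle h0).trans (T.tsum_coreWt₀_mul_norm_le Dx hs)⟩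

end mBound

/-! ### Removal data -/

/-- **A multiple zero `ρ ≠ 1/2` of `Ξ_T` is carried by two distinct node indices of weight `1`.** [cite: ThornerZaman2017, §7.2] -/
theorem exists_two_idx_of_double {ρ : ℂ} (hρ : T.xiPair ρ = 0) (hρ' : deriv T.xiPair ρ = 0) (h : ρ ≠ 1 / 2) :
    ∃ q₁ q₂ : ℕ × Bool, q₁ ≠ q₂ ∧ Dx.nodeWt q₁ = 1 ∧ Dx.nodeWt q₂ = 1 ∧ Dx.nodeVal q₁ = ρ ∧ Dx.nodeVal q₂ = ρ ∧
      Dx.nodeVal (q₁.1, !q₁.2) = 1 - ρ ∧ Dx.nodeVal (q₂.1, !q₂.2) = 1 - ρ := by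
  obtain ⟨n₁, n₂, hne, h₁, h₂⟩ := Dx.exists_two_indices_of_deriv_eq_zero hρ hρ' h
  obtain ⟨b₁, hb₁, hb₁'⟩ := Dx.nodeVal_pair_of_root h₁
  obtain ⟨b₂, hb₂, hb₂'⟩ := Dx.nodeVal_pair_of_root h₂
  have hc₁ : Dx.c n₁ ≠ 0 := by rintro h0; rw [h0, zero_mul] at h₁; norm_num at h₁
  have hc₂ : Dx.c n₂ ≠ 0 := by rintro h0; rw [h0, zero_mul] at h₂; norm_num at h₂
  exact ⟨(n₁, b₁), (n₂, b₂), fun h ↦ hne (congrArg Prod.fst h), Dx.nodeWt_eq_one_iff.mpr hc₁,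
    Dx.nodeWt_eq_one_iff.mpr hc₂, hb₁, hb₂, hb₁', hb₂'⟩

/-- The indices removed from the core family: two factor indices `A` carrying the artificial zeros `{1, 0}` of
`Ξ_T` (always present) and, if `w`, two node indices `B` carrying the exceptional zero `β`.
[cite: ThornerZaman2017, §7.2 ("ω ≠ β₁")] -/
structure CoreRemoval (β : ℂ) (w : Prop) where
  /-- factor indices carrying the pair of zeros `{1, 0}` -/
  A : Finset ℕ
  /-- node indices carrying `β` -/
  B : Finset (ℕ × Bool)
  hA : ∀ n ∈ A, Dx.c n * (1 - 1 / 2) ^ 2 = -1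
  hB : ∀ q ∈ B, Dx.nodeWt q = 1 ∧ Dx.nodeVal q = β
  hAB : ∀ q ∈ B, q.1 ∉ A
  cardA : A.card = 2
  cardB : (B.card : ℝ) = 2 * (if w then 1 else 0)

/-- **Existence of the removal data** (`β ∉ {0, 1/2, 1}`; when `w` holds, `β` must be a multiple zero of `Ξ_T`).
[cite: ThornerZaman2017, §7.2] -/
theorem exists_coreRemoval {β : ℂ} (hβ : β ≠ 1 / 2) (hβ0 : β ≠ 0) (hβ1 : β ≠ 1) (w : Prop)
    (hw : w → T.xiPair β = 0 ∧ deriv T.xiPair β = 0) : Nonempty (T.CoreRemoval Dx β w) := by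
  -- the artificial indices
  obtain ⟨n₁, n₂, hne, h₁, h₂⟩ := Dx.exists_two_indices_of_deriv_eq_zero T.xiPair_one.1 T.xiPair_one.2
    (by norm_num)
  set A : Finset ℕ := {n₁, n₂} with hAdef
  have hA : ∀ n ∈ A, Dx.c n * (1 - 1 / 2) ^ 2 = -1 := by
    intro n hn
    rcases Finset.mem_insert.mp hn with rfl | hn
    · exact h₁
    · rw [Finset.mem_singleton.mp hn]; exact h₂
  have hcardA : A.card = 2 := by rw [hAdef, Finset.card_pair hne]
  -- nodes of the artificial indices are `1` or `0`
  have hAval : ∀ q : ℕ × Bool, q.1 ∈ A → Dx.nodeVal q = 1 ∨ Dx.nodeVal q = 0 := by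
    intro q hq
    obtain ⟨b, hb, hb'⟩ := Dx.nodeVal_pair_of_root (hA q.1 hq)
    rw [sub_self] at hb'
    rcases q with ⟨n, b'⟩
    by_cases hbb : b' = b
    · subst hbb; exact Or.inl hb
    · have : b' = !b := by cases b <;> cases b' <;> simp_all
      subst this; exact Or.inr hb'
  by_cases hwp : w
  · obtain ⟨q₁, q₂, hne', hw1, hw2, hv1, hv2, -, -⟩ := T.exists_two_idx_of_double Dx (hw hwp).1 (hw hwp).2 hβ
    refine ⟨⟨A, {q₁, q₂}, hA, ?_, ?_, hcardA, ?_⟩⟩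
    · intro q hq
      rcases Finset.mem_insert.mp hq with rfl | hq
      · exact ⟨hw1, hv1⟩
      · rw [Finset.mem_singleton.mp hq]; exact ⟨hw2, hv2⟩
    · intro q hq hqA
      have hv : Dx.nodeVal q = β := by
        rcases Finset.mem_insert.mp hq with rfl | hq
        · exact hv1
        · rw [Finset.mem_singleton.mp hq]; exact hv2
      rcases hAval q hqA with h | h
      · exact hβ1 (hv ▸ h)
      · exact hβ0 (hv ▸ h)
    · rw [Finset.card_pair hne']; simp [hwp]
  · exact ⟨⟨A, ∅, hA, by simp, by simp, hcardA, by simp [hwp]⟩⟩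

end RayXiData


end Literature.NumberTheory.LFunctions

end
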